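import Literature.InformationTheory.QuantumCodes.SubsystemCodeGaugeLocalDistanceBound
import Literature.InformationTheory.QuantumCodes.LocalCodeTradeoffTorus
import HarnessLib

/-!
# Bravyi–Terhal 2009, Theorem 3 with periodic boundary conditions — proof

S. Bravyi, B. Terhal, arXiv:0810.1983 [BravyiTerhal2009], §1.3 Thm. 3 (chunk p0007 L93–100: «`d ≤ 3r L^{D−1}`»)
and §3.1 (p0011 L105–107: «For simplicity we present a proof for `D = 1` and open boundary conditions.
Generalization to higher dimensions and periodic boundary conditions is straightforward»).

THIS FILE PROVES the periodic case left as `TODO(general form)` in `SubsystemCodeGaugeLocalDistanceBound.lean`: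
`BravyiTerhal2009_theorem3_periodic` — on the torus `(ℤ/L)^D`, for every gauge space `Ḡ` spanned by elements in
periodic windows with `r^D` vertices, `k ≥ 1`: `d ≤ 3 r L^{D−1}`.

Proof: the open-boundary argument is first abstracted from its geometry (`GaugeRestrict.dist_le_of_split`: a region
`M` with a logical pair, a cleaning set `B_c ⊆ M` whose removal splits `M` into parts `A`, `C` that no generator
joins and that carry no logical pair, and a set `B_d` catching every generator leaving `M`, force
`d ≤ |B_c| + |B_d|` — Restriction Lemma in one case, the subsystem Cleaning Lemma in the other). On the torus the
minimal cyclic strip `M` (in the coordinate shifted by its first column) is split as in print when it leaves at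
least `r − 1` columns free (`B_c` = the `r − 1` columns after the first, `B_d` = `r − 1` columns on each side);
when it covers all but fewer than `r − 1` columns, the two ends of `M` are adjacent across the seam and the split
uses the `r − 1` columns at BOTH ends of `M` as the cleaning set (`2(r−1)` columns) while `B_d` = the `< r − 1`
free columns — in both cases `|B_c| + |B_d| ≤ 3(r−1)L^{D−1}`.

## Mathlib / tree search

Tree: `GaugeRestrict.{restrictGauge, HasLogicalPairOn, restrictGauge_le_supportedOn, mem_sympDual_restrictGauge_iff,
dist_le_card_of_pair, hasLogicalPairOn_univ, exists_dressed_extension}` (SubsystemCodeGaugeLocalDistanceBound.lean);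
`BPTTorus.{Close, close_of_inCubePeriodic}` (LocalCodeTradeoffTorus.lean); `card_filter_apply_zero_mem`
(LocalCodeDistanceBound.lean); `sup_gaugeStabilizer_bare_compl_eq`, `exists_dressed_of_pos` (SubsystemCodes.lean).
-/

namespace Literature.InformationTheory.QuantumCodes

open Finset Module
open Classical

variable {n : ℕ}

namespace GaugeRestrict

/-! ### The split argument, abstractly -/

section Split

variable {G : Submodule (ZMod 2) (SympVec n)}

/-- Additivity of the symplectic product in the second argument. [folklore] -/
private theorem sympInner_add_right'' (u v w : SympVec n) :
    sympInner u (v + w) = sympInner u v + sympInner u w := by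
  rw [sympInner_comm, sympInner_add_left, sympInner_comm v, sympInner_comm w]

/-- Support bookkeeping. [folklore] -/
private theorem mem_supportedOn_of_inter' {X Y Z : Finset (Fin n)} {v : SympVec n} (hX : v ∈ supportedOn X)
    (hY : v ∈ supportedOn Y) (h : ∀ i, i ∈ X → i ∈ Y → i ∈ Z) : v ∈ supportedOn Z := by
  intro i hi
  by_cases hiX : i ∈ X
  · by_cases hiY : i ∈ Y
    · exact absurd (h i hiX hiY) hi
    · exact hY i hiY
  · exact hX i hiX

/-- **The split step of the proof of Theorem 3, abstractly.** `Ḡ = ⟨γ⟩`; `M` carries a logical pair of bare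
operators; `B_c ⊆ M` and `M ∖ B_c ⊆ A ∪ C` with `A, C ⊆ M` carrying NO logical pair; every generator meeting `M`
stays inside `M ∪ B_d`; no generator meets both `A` and `C`. Then `d ≤ |B_c| + |B_d|`: either `B_c` supports a
dressed logical operator of the restricted code `𝒢_M` (Restriction Lemma: a dressed logical operator of `Ḡ` on
`B_c ∪ B_d`), or `B_c` is correctable for `𝒢_M`, the pair is cleaned off `B_c`, splits across the gap into bare
pieces on `A` and on `C`, one of which is again a logical pair — excluded.
[cite: BravyiTerhal2009, §3.1 proof of Thm. 3 (pp. 11–12)] -/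
theorem dist_le_of_split {ι : Type*} [Fintype ι] (γ : ι → SympVec n)
    (hG : G = Submodule.span (ZMod 2) (Set.range γ)) {d : ℕ} (hdist : HasSubsystemMinDist G d)
    {M A C Bc Bd : Finset (Fin n)} (hpair : HasLogicalPairOn G M) (hnoA : ¬ HasLogicalPairOn G A)
    (hnoC : ¬ HasLogicalPairOn G C) (hcover : ∀ q, q ∈ M → q ∉ Bc → q ∈ A ∪ C) (hBcM : Bc ⊆ M)
    (hbd : ∀ b, (∃ q ∈ sympSupport (γ b), q ∈ M) → ∀ q ∈ sympSupport (γ b), q ∉ M → q ∈ Bd)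
    (hgapA : ∀ b, (∃ q ∈ sympSupport (γ b), q ∈ A) → γ b ∈ supportedOn Cᶜ)
    (hgapC : ∀ b, (∃ q ∈ sympSupport (γ b), q ∈ C) → γ b ∈ supportedOn Aᶜ) :
    d ≤ #Bc + #Bd := by
  set GM := restrictGauge G M with hGM
  by_cases hcase : ∃ R ∈ sympDual (gaugeStabilizer GM), R ∈ supportedOn Bc ∧ R ∉ GM
  · -- (i) B_c carries a dressed logical operator of 𝒢_M
    obtain ⟨R, hRd, hRB, hRG⟩ := hcase
    have hRM : R ∈ supportedOn M := fun i hi => hRB i fun hiB => hi (hBcM hiB)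
    obtain ⟨R', hR'd, hR'G, hR's⟩ := exists_dressed_extension γ hG hbd hRM hRd hRG
    have hR'BBd : R' ∈ supportedOn (Bc ∪ Bd) := by
      intro i hi
      refine hR's i fun hi' => hi ?_
      rw [mem_filter] at hi'
      rw [mem_union]
      rcases hi'.2 with h | h
      · left
        by_contra hiB
        have := hRB i hiB
        rcases h with h | h
        · exact h this.1
        · exact h this.2
      · exact Or.inr h
    calc d ≤ sympWeight R' := hdist R' hR'd hR'G
      _ ≤ #(Bc ∪ Bd) := sympWeight_le_card_of_mem hR'BBd
      _ ≤ #Bc + #Bd := card_union_le _ _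
  · -- (ii) B_c is correctable for 𝒢_M: clean, split, contradiction
    exfalso
    push Not at hcase
    have hBcorr : IsGaugeCorrectable GM Bc := fun R hR hRB => hcase R hR hRB
    have hclean := sup_gaugeStabilizer_bare_compl_eq hBcorr
    obtain ⟨P, hPd, hPM, Q, hQd, hQM, hPQ⟩ := hpair
    have hPd' : P ∈ sympDual GM := (mem_sympDual_restrictGauge_iff hPM).2 hPd
    have hQd' : Q ∈ sympDual GM := (mem_sympDual_restrictGauge_iff hQM).2 hQd
    have hP2 : P ∈ gaugeStabilizer GM ⊔ (sympDual GM ⊓ supportedOn Bcᶜ) := by rw [hclean]; exact hPd'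
    have hQ2 : Q ∈ gaugeStabilizer GM ⊔ (sympDual GM ⊓ supportedOn Bcᶜ) := by rw [hclean]; exact hQd'
    obtain ⟨s₁, hs₁, P', ⟨hP'd, hP'B⟩, rfl⟩ := Submodule.mem_sup.1 hP2
    obtain ⟨s₂, hs₂, Q', ⟨hQ'd, hQ'B⟩, rfl⟩ := Submodule.mem_sup.1 hQ2
    have hS'le : gaugeStabilizer GM ≤ GM := gaugeStabilizer_le GM
    have h11 : sympInner s₁ s₂ = 0 := (mem_sympDual_iff.1 (isSelfOrthogonal_gaugeStabilizer GM hs₂)) s₁ hs₁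
    have h12 : sympInner s₁ Q' = 0 := (mem_sympDual_iff.1 hQ'd) s₁ (hS'le hs₁)
    have h21 : sympInner P' s₂ = 0 := by
      rw [sympInner_comm]; exact (mem_sympDual_iff.1 hP'd) s₂ (hS'le hs₂)
    have hP'Q' : sympInner P' Q' ≠ 0 := by
      intro h0
      apply hPQ
      rw [sympInner_add_left, sympInner_add_right'', sympInner_add_right'', h11, h12, h21, h0]
      simp
    have hs₁M : s₁ ∈ supportedOn M := restrictGauge_le_supportedOn (hS'le hs₁)
    have hs₂M : s₂ ∈ supportedOn M := restrictGauge_le_supportedOn (hS'le hs₂)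
    have hP'M : P' ∈ supportedOn M := by
      have := (supportedOn M).sub_mem hPM hs₁M; simpa using this
    have hQ'M : Q' ∈ supportedOn M := by
      have := (supportedOn M).sub_mem hQM hs₂M; simpa using this
    have hP'AC : P' ∈ supportedOn (A ∪ C) :=
      mem_supportedOn_of_inter' hP'M hP'B fun i hiM hiB => hcover i hiM (by simpa using hiB)
    have hQ'AC : Q' ∈ supportedOn (A ∪ C) :=
      mem_supportedOn_of_inter' hQ'M hQ'B fun i hiM hiB => hcover i hiM (by simpa using hiB)
    have hP'G : P' ∈ sympDual G := (mem_sympDual_restrictGauge_iff hP'M).1 hP'd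
    have hQ'G : Q' ∈ sympDual G := (mem_sympDual_restrictGauge_iff hQ'M).1 hQ'd
    have hsplitC : ∀ {X : SympVec n}, X ∈ supportedOn (A ∪ C) → proj Aᶜ X ∈ supportedOn C := by
      intro X hX
      refine mem_supportedOn_of_inter' (proj_mem_supportedOn_of_mem Aᶜ hX) (proj_mem_supportedOn Aᶜ X)
        fun i hiAC hiAc => ?_
      rw [mem_union] at hiAC
      rw [mem_compl] at hiAc
      exact hiAC.resolve_left hiAc
    have hpieceA : ∀ {X : SympVec n}, X ∈ sympDual G → X ∈ supportedOn (A ∪ C) → proj A X ∈ sympDual G := by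
      intro X hXd hXAC
      rw [hG]
      refine mem_sympDual_span_of_forall _ fun b => ?_
      by_cases hmeet : ∃ q ∈ sympSupport (γ b), q ∈ A
      · have htot : sympInner (γ b) X = 0 :=
          (mem_sympDual_iff.1 hXd) _ (by rw [hG]; exact Submodule.subset_span ⟨b, rfl⟩)
        have hC0 : sympInner (γ b) (proj Aᶜ X) = 0 := by
          rw [sympInner_comm]
          exact sympInner_eq_zero_of_supportedOn_compl (hsplitC hXAC) (by simpa using hgapA b hmeet)
        rw [← proj_add_proj_compl A X, sympInner_add_right'', hC0, add_zero] at htot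
        exact htot
      · push Not at hmeet
        have hb : γ b ∈ supportedOn Aᶜ :=
          mem_supportedOn_of_forall_sympSupport fun q hq => by simpa using hmeet q hq
        rw [sympInner_comm]
        exact sympInner_eq_zero_of_supportedOn_compl (proj_mem_supportedOn A X) hb
    have hpieceC : ∀ {X : SympVec n}, X ∈ sympDual G → X ∈ supportedOn (A ∪ C) → proj Aᶜ X ∈ sympDual G := by
      intro X hXd hXAC
      rw [hG]
      refine mem_sympDual_span_of_forall _ fun b => ?_
      by_cases hmeet : ∃ q ∈ sympSupport (γ b), q ∈ C
      · have htot : sympInner (γ b) X = 0 :=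
          (mem_sympDual_iff.1 hXd) _ (by rw [hG]; exact Submodule.subset_span ⟨b, rfl⟩)
        have hA0 : sympInner (γ b) (proj A X) = 0 := by
          rw [sympInner_comm]
          exact sympInner_eq_zero_of_supportedOn_compl (proj_mem_supportedOn A X) (hgapC b hmeet)
        rw [← proj_add_proj_compl A X, sympInner_add_right'', hA0, zero_add] at htot
        exact htot
      · push Not at hmeet
        have hb : γ b ∈ supportedOn Cᶜ :=
          mem_supportedOn_of_forall_sympSupport fun q hq => by simpa using hmeet q hq
        rw [sympInner_comm]
        exact sympInner_eq_zero_of_supportedOn_compl (hsplitC hXAC) (by simpa using hb)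
    have hsum : sympInner P' Q' =
        sympInner (proj A P') (proj A Q') + sympInner (proj Aᶜ P') (proj Aᶜ Q') := by
      conv_lhs => rw [← proj_add_proj_compl A P', ← proj_add_proj_compl A Q']
      rw [sympInner_add_left, sympInner_add_right'', sympInner_add_right'',
        sympInner_eq_zero_of_supportedOn_compl (proj_mem_supportedOn A P') (proj_mem_supportedOn Aᶜ Q'),
        sympInner_comm (proj Aᶜ P') (proj A Q'),
        sympInner_eq_zero_of_supportedOn_compl (proj_mem_supportedOn A Q') (proj_mem_supportedOn Aᶜ P')]
      abel
    by_cases hA0 : sympInner (proj A P') (proj A Q') ≠ 0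
    · exact hnoA ⟨proj A P', hpieceA hP'G hP'AC, proj_mem_supportedOn A P',
        proj A Q', hpieceA hQ'G hQ'AC, proj_mem_supportedOn A Q', hA0⟩
    · rw [not_not] at hA0
      have hC0 : sympInner (proj Aᶜ P') (proj Aᶜ Q') ≠ 0 := by
        intro h0; apply hP'Q'; rw [hsum, hA0, h0, add_zero]
      exact hnoC ⟨proj Aᶜ P', hpieceC hP'G hP'AC, hsplitC hP'AC,
        proj Aᶜ Q', hpieceC hQ'G hQ'AC, hsplitC hQ'AC, hC0⟩

end Split

/-! ### Cyclic strips -/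

section CStrips

variable {D' L : ℕ} (e : Fin n ≃ (Fin (D' + 1) → Fin L))

/-- The **cyclic strip** of the columns `a + s, …, a + s + m − 1 (mod L)`: qubits whose first coordinate, shifted
by `a`, lies in `[s, s + m)`. Column: definition. [cite: BravyiTerhal2009, §3.1 proof of Thm. 3 («the smallest contiguous block of qubits … periodic boundary conditions»)] -/
def cstrip (a : Fin L) (s m : ℕ) : Finset (Fin n) :=
  univ.filter fun q => s ≤ ((e q 0 - a : Fin L) : ℕ) ∧ ((e q 0 - a : Fin L) : ℕ) < s + m

variable {e}

/-- Membership in a cyclic strip. [cite: BravyiTerhal2009, §3.1 proof of Thm. 3] -/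
@[simp] theorem mem_cstrip {a : Fin L} {s m : ℕ} {q : Fin n} :
    q ∈ cstrip e a s m ↔ s ≤ ((e q 0 - a : Fin L) : ℕ) ∧ ((e q 0 - a : Fin L) : ℕ) < s + m := by
  simp [cstrip]

/-- Value of a difference in `Fin L`. [folklore] -/
private theorem val_sub_eq' {L : ℕ} (y c : Fin L) :
    ((y - c : Fin L) : ℕ) = if (c : ℕ) ≤ y then (y : ℕ) - c else (y : ℕ) + L - c := by
  split_ifs with h
  · exact Fin.coe_sub_iff_le.2 h
  · rw [Fin.coe_sub_iff_lt.2 (Fin.lt_def.2 (by omega))]; omega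

/-- A cyclic strip of `m` columns has at most `m · L^{D−1}` qubits. [cite: BravyiTerhal2009, §2 proof of Thm. 1 («weight at most rL^{D−1}»)] -/
theorem card_cstrip_le (a : Fin L) (s m : ℕ) : #(cstrip e a s m) ≤ m * L ^ D' := by
  haveI : NeZero L := ⟨(Fin.pos a).ne'⟩
  set C : Finset (Fin L) := univ.filter fun x : Fin L => s ≤ ((x - a : Fin L) : ℕ) ∧ ((x - a : Fin L) : ℕ) < s + m
    with hC
  have hs : cstrip e a s m = (univ.filter fun x : Fin (D' + 1) → Fin L => x 0 ∈ C).map e.symm.toEmbedding := by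
    ext q
    simp [cstrip, hC, Finset.mem_map_equiv]
  rw [hs, Finset.card_map, card_filter_apply_zero_mem]
  refine Nat.mul_le_mul_right _ ?_
  calc #C ≤ #(Finset.Ico s (s + m)) := by
        refine card_le_card_of_injOn (fun x : Fin L => ((x - a : Fin L) : ℕ)) (fun x hx => ?_) ?_
        · have hx' := (mem_filter.1 (mem_coe.1 hx)).2
          simpa [Finset.mem_Ico] using hx'
        · intro x₁ _ x₂ _ h
          have : (x₁ - a : Fin L) = x₂ - a := Fin.ext h
          exact sub_left_inj.1 this
    _ = m := by simp

/-- The cyclic strip of all columns is the whole lattice. [cite: BravyiTerhal2009, §3.1 proof of Thm. 3] -/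
theorem cstrip_zero_eq_univ (a : Fin L) {m : ℕ} (hm : L ≤ m) : cstrip e a 0 m = univ := by
  ext q
  simp only [mem_cstrip, zero_le, true_and, zero_add, mem_univ, iff_true]
  exact lt_of_lt_of_le (e q 0 - a).isLt hm

/-- Re-basing an offset strip inside the circle: `[s, s + m)` after `a` = `[0, m)` after `a + s` (`s + m ≤ L`).
[cite: BravyiTerhal2009, §3.1 proof of Thm. 3] -/
theorem cstrip_eq_cstrip_add {a : Fin L} {s m : ℕ} (hsL : s < L) (hsm : s + m ≤ L) :
    cstrip e a s m = cstrip e (a + ⟨s, hsL⟩) 0 m := by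
  haveI : NeZero L := ⟨(Fin.pos a).ne'⟩
  ext q
  simp only [mem_cstrip, zero_le, true_and, zero_add]
  have hsub : (e q 0 - (a + ⟨s, hsL⟩) : Fin L) = (e q 0 - a) - ⟨s, hsL⟩ := (sub_sub _ _ _).symm
  rw [hsub, val_sub_eq' (e q 0 - a) ⟨s, hsL⟩]
  have := (e q 0 - a).isLt
  simp only
  split_ifs with h <;> omega

/-- Cyclic closeness is invariant under the shift by `a`. [folklore] -/
private theorem close_shift {t : ℕ} {x y : Fin L} (a : Fin L) (h : BPTTorus.Close L t (x : ℕ) (y : ℕ)) :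
    BPTTorus.Close L t ((x - a : Fin L) : ℕ) ((y - a : Fin L) : ℕ) := by
  rw [val_sub_eq' x a, val_sub_eq' y a]
  have := x.isLt
  have := y.isLt
  have := a.isLt
  unfold BPTTorus.Close at h ⊢
  split_ifs <;> omega

end CStrips

end GaugeRestrict

open GaugeRestrict BPTTorus

/-! ### Theorem 3 on the torus -/

/-- **Bravyi–Terhal 2009, Theorem 3 with periodic boundary conditions — proved** (every `D ≥ 1` and `L`).
For every gauge space `Ḡ` on the torus `(ℤ/L)^D` spanned by its elements each covered by a periodic window with
`r^D` vertices (`r ≥ 1`), with `k ≥ 1` logical qubits and no dressed logical operator of weight `< d`: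
`d ≤ 3 r L^{D−1}`. Column: proved theorem. [cite: BravyiTerhal2009, §1.3 Thm. 3 (p. 7) with §3.1 («Generalization to higher dimensions and periodic boundary conditions is straightforward», p. 11)] -/
theorem BravyiTerhal2009_theorem3_periodic (D L r : ℕ) {k d : ℕ} (e : Fin n ≃ (Fin D → Fin L))
    (G : Submodule (ZMod 2) (SympVec n)) (hD : 1 ≤ D) (hr : 1 ≤ r) (hloc : HasLocalGeneratorsPeriodic e r G)
    (hcode : IsSubsystemCode G k d) (hk : 1 ≤ k) : d ≤ 3 * r * L ^ (D - 1) := by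
  obtain ⟨D', rfl⟩ : ∃ D', D = D' + 1 := ⟨D - 1, by omega⟩
  rw [Nat.add_sub_cancel]
  have hn : n = L ^ (D' + 1) := by simpa using Fintype.card_congr e
  -- d ≤ n, hence the claim for L ≤ 3r
  obtain ⟨P₀, hP₀d, hP₀G⟩ := exists_dressed_of_pos hcode hk
  have hdn : d ≤ n :=
    (hcode.2 P₀ hP₀d hP₀G).trans ((sympWeight_le_card_of_mem (M := univ) fun i hi => absurd (mem_univ i) hi).trans
      (by simp))
  by_cases hL3 : L ≤ 3 * r
  · calc d ≤ n := hdn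
      _ = L * L ^ D' := by rw [hn, pow_succ, mul_comm]
      _ ≤ 3 * r * L ^ D' := Nat.mul_le_mul_right _ hL3
  rw [not_le] at hL3
  have hL : 0 < L := by omega
  haveI : NeZero L := ⟨hL.ne'⟩
  -- the local gauge generators, windows of range t + 1 = r
  obtain ⟨t, rfl⟩ : ∃ t, r = t + 1 := ⟨r - 1, by omega⟩
  set T : Set (SympVec n) := {v | v ∈ G ∧ IsCubeLocalPeriodic e (t + 1) v} with hT
  haveI : Fintype T := Fintype.ofFinite T
  have hG : G = Submodule.span (ZMod 2) (Set.range (Subtype.val : T → SympVec n)) := by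
    rw [Subtype.range_coe]
    exact le_antisymm hloc (Submodule.span_le.2 fun v hv => hv.1)
  have hγ : ∀ b : T, IsCubeLocalPeriodic e (t + 1) (b : SympVec n) := fun b => b.2.2
  -- two qubits of one generator are cyclically close in the shifted first coordinate
  have hclose : ∀ (a : Fin L) (b : T), ∀ q₁ ∈ sympSupport (b : SympVec n), ∀ q ∈ sympSupport (b : SympVec n),
      Close L t ((e q₁ 0 - a : Fin L) : ℕ) ((e q 0 - a : Fin L) : ℕ) := by
    intro a b q₁ hq₁ q hq
    obtain ⟨c, hc⟩ := hγ b
    exact close_shift a (close_of_inCubePeriodic (e := e) (hc q₁ hq₁) (hc q hq) 0)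
  -- minimal cyclic strip width carrying a logical pair
  have hex : ∃ m, ∃ a : Fin L, HasLogicalPairOn G (cstrip e a 0 m) :=
    ⟨L, ⟨0, hL⟩, by rw [cstrip_zero_eq_univ _ (le_refl L)]; exact hasLogicalPairOn_univ hcode hk⟩
  set m₀ := Nat.find hex with hm₀
  obtain ⟨a, hpair⟩ : ∃ a : Fin L, HasLogicalPairOn G (cstrip e a 0 m₀) := Nat.find_spec hex
  have hmin : ∀ m < m₀, ∀ a' : Fin L, ¬ HasLogicalPairOn G (cstrip e a' 0 m) :=
    fun m hm a' h => Nat.find_min hex hm ⟨a', h⟩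
  have hm₀L : m₀ ≤ L := Nat.find_min' hex ⟨⟨0, hL⟩, by
    rw [cstrip_zero_eq_univ _ (le_refl L)]; exact hasLogicalPairOn_univ hcode hk⟩
  -- narrow minimal strip
  by_cases hsmall : m₀ ≤ t + 1
  · calc d ≤ #(cstrip e a 0 m₀) := dist_le_card_of_pair hcode.2 hpair
      _ ≤ m₀ * L ^ D' := card_cstrip_le a 0 m₀
      _ ≤ 3 * (t + 1) * L ^ D' := Nat.mul_le_mul_right _ (by omega)
  rw [not_le] at hsmall
  set M : Finset (Fin n) := cstrip e a 0 m₀ with hMdef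
  set A : Finset (Fin n) := cstrip e a 0 1 with hAdef
  have hnoA : ¬ HasLogicalPairOn G A := hmin 1 (by omega) a
  -- shorthand for the shifted coordinate
  have hy : ∀ q : Fin n, ((e q 0 - a : Fin L) : ℕ) < L := fun q => (e q 0 - a).isLt
  by_cases hI : m₀ + t ≤ L
  · -- Case I: the strip leaves ≥ t free columns — the printed split
    set Bc : Finset (Fin n) := cstrip e a 1 t with hBcdef
    set C : Finset (Fin n) := cstrip e a (t + 1) (m₀ - (t + 1)) with hCdef
    set Bd : Finset (Fin n) := cstrip e a m₀ t ∪ cstrip e a (L - t) t with hBddef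
    have hCeq : C = cstrip e (a + ⟨t + 1, by omega⟩) 0 (m₀ - (t + 1)) :=
      cstrip_eq_cstrip_add (by omega) (by omega)
    have hnoC : ¬ HasLogicalPairOn G C := by rw [hCeq]; exact hmin _ (by omega) _
    have hbound := dist_le_of_split (Subtype.val : T → SympVec n) hG hcode.2 hpair hnoA hnoC
      (M := M) (Bc := Bc) (Bd := Bd)
      (fun q hq hqB => by
        rw [hMdef, mem_cstrip] at hq
        rw [hBcdef, mem_cstrip] at hqB
        rw [mem_union, hAdef, hCdef, mem_cstrip, mem_cstrip]
        omega)
      (fun q hq => by rw [hBcdef, mem_cstrip] at hq; rw [hMdef, mem_cstrip]; omega)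
      (fun b ⟨q₁, hq₁, hq₁M⟩ q hq hqM => by
        have hc := hclose a b q₁ hq₁ q hq
        rw [hMdef, mem_cstrip] at hq₁M hqM
        rw [hBddef, mem_union, mem_cstrip, mem_cstrip]
        have := hy q; have := hy q₁
        unfold Close at hc
        omega)
      (fun b ⟨q₁, hq₁, hq₁A⟩ => by
        rw [hAdef, mem_cstrip] at hq₁A
        refine mem_supportedOn_of_forall_sympSupport fun q hq => ?_
        have hc := hclose a b q₁ hq₁ q hq
        rw [mem_compl, hCdef, mem_cstrip]
        have := hy q; have := hy q₁
        unfold Close at hc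
        omega)
      (fun b ⟨q₁, hq₁, hq₁C⟩ => by
        rw [hCdef, mem_cstrip] at hq₁C
        refine mem_supportedOn_of_forall_sympSupport fun q hq => ?_
        have hc := hclose a b q₁ hq₁ q hq
        rw [mem_compl, hAdef, mem_cstrip]
        have := hy q; have := hy q₁
        unfold Close at hc
        omega)
    calc d ≤ #Bc + #Bd := hbound
      _ ≤ t * L ^ D' + (t * L ^ D' + t * L ^ D') := by
          refine Nat.add_le_add (card_cstrip_le _ _ _) ((card_union_le _ _).trans ?_)
          exact Nat.add_le_add (card_cstrip_le _ _ _) (card_cstrip_le _ _ _)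
      _ = 3 * t * L ^ D' := by ring
      _ ≤ 3 * (t + 1) * L ^ D' := Nat.mul_le_mul_right _ (by omega)
  · -- Case II: the strip covers all but < t columns — clean both ends of the strip
    rw [not_le] at hI
    set Bc : Finset (Fin n) := cstrip e a 1 t ∪ cstrip e a (m₀ - t) t with hBcdef
    set C : Finset (Fin n) := cstrip e a (t + 1) (m₀ - t - (t + 1)) with hCdef
    set Bd : Finset (Fin n) := cstrip e a m₀ t with hBddef
    have hCeq : C = cstrip e (a + ⟨t + 1, by omega⟩) 0 (m₀ - t - (t + 1)) :=
      cstrip_eq_cstrip_add (by omega) (by omega)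
    have hnoC : ¬ HasLogicalPairOn G C := by rw [hCeq]; exact hmin _ (by omega) _
    have hbound := dist_le_of_split (Subtype.val : T → SympVec n) hG hcode.2 hpair hnoA hnoC
      (M := M) (Bc := Bc) (Bd := Bd)
      (fun q hq hqB => by
        rw [hMdef, mem_cstrip] at hq
        rw [hBcdef, mem_union, mem_cstrip, mem_cstrip] at hqB
        rw [mem_union, hAdef, hCdef, mem_cstrip, mem_cstrip]
        omega)
      (fun q hq => by
        rw [hBcdef, mem_union, mem_cstrip, mem_cstrip] at hq; rw [hMdef, mem_cstrip]; omega)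
      (fun b ⟨q₁, hq₁, hq₁M⟩ q hq hqM => by
        rw [hMdef, mem_cstrip] at hq₁M hqM
        rw [hBddef, mem_cstrip]
        have := hy q
        omega)
      (fun b ⟨q₁, hq₁, hq₁A⟩ => by
        rw [hAdef, mem_cstrip] at hq₁A
        refine mem_supportedOn_of_forall_sympSupport fun q hq => ?_
        have hc := hclose a b q₁ hq₁ q hq
        rw [mem_compl, hCdef, mem_cstrip]
        have := hy q; have := hy q₁
        unfold Close at hc
        omega)
      (fun b ⟨q₁, hq₁, hq₁C⟩ => by
        rw [hCdef, mem_cstrip] at hq₁C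
        refine mem_supportedOn_of_forall_sympSupport fun q hq => ?_
        have hc := hclose a b q₁ hq₁ q hq
        rw [mem_compl, hAdef, mem_cstrip]
        have := hy q; have := hy q₁
        unfold Close at hc
        omega)
    calc d ≤ #Bc + #Bd := hbound
      _ ≤ (t * L ^ D' + t * L ^ D') + t * L ^ D' := by
          refine Nat.add_le_add ((card_union_le _ _).trans ?_) (card_cstrip_le _ _ _)
          exact Nat.add_le_add (card_cstrip_le _ _ _) (card_cstrip_le _ _ _)
      _ = 3 * t * L ^ D' := by ring
      _ ≤ 3 * (t + 1) * L ^ D' := Nat.mul_le_mul_right _ (by omega)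

end Literature.InformationTheory.QuantumCodes
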